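import Summits.RiemannHypothesis.RiemannHypothesis.Theorems.IntegerScrewCensusFastRowsErr

/-!
# Route `IntegerScrew` — fast kernel arithmetic for manifest-certificate checks (4c): list plumbing of the trig rows

Structural facts about the row builders of `IntegerScrewCensusFastRows` that the row invariant (`rows_err`, successor
work, HOME/sos/CENSUS-KERNEL-IMPORT-engA.md §4) consumes: `smallFactor m ∣ m`, its range, idempotence on its values;
pointwise descriptions and lengths of `primeRow` and `stepRow`; propagation of the range flag; `buildRows` keeps its
flag monotone and its length bookkeeping.  No analysis; RH-free; nothing here bears on the truth of RH.
-/

set_option linter.dupNamespace false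
set_option autoImplicit false

namespace Summit.RiemannHypothesis.RiemannHypothesis.Theorems.IntegerScrew.Manifest.Fast

open Finset

/-! ### `smallFactor` -/

/-- `smallFactor m` divides `m`. -/
theorem smallFactor_dvd (m : ℕ) : smallFactor m ∣ m := by
  unfold smallFactor
  split_ifs with h2 h3 h5 h7 h11 h13
  · exact Nat.dvd_of_mod_eq_zero h2
  · exact Nat.dvd_of_mod_eq_zero h3
  · exact Nat.dvd_of_mod_eq_zero h5
  · exact Nat.dvd_of_mod_eq_zero h7
  · exact Nat.dvd_of_mod_eq_zero h11
  · exact Nat.dvd_of_mod_eq_zero h13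
  · exact dvd_rfl

/-- `smallFactor m` is `m` itself or one of `2, 3, 5, 7, 11, 13`. -/
theorem smallFactor_cases (m : ℕ) :
    smallFactor m = m ∨ smallFactor m = 2 ∨ smallFactor m = 3 ∨ smallFactor m = 5 ∨ smallFactor m = 7 ∨
      smallFactor m = 11 ∨ smallFactor m = 13 := by
  unfold smallFactor
  split_ifs <;> simp

/-- `2 ≤ smallFactor m` for `2 ≤ m`. -/
theorem two_le_smallFactor {m : ℕ} (hm : 2 ≤ m) : 2 ≤ smallFactor m := by
  rcases smallFactor_cases m with h | h | h | h | h | h | h <;> omega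

/-- On its small values `smallFactor` is the identity (so those nodes are BASE nodes of depth `1`). -/
theorem smallFactor_idem (m : ℕ) : smallFactor (smallFactor m) = smallFactor m := by
  rcases smallFactor_cases m with h | h | h | h | h | h | h
  · rw [h]; exact h
  all_goals rw [h]; decide

/-- A proper small factor splits `m ≥ 2` as `p · (m/p)` with both factors in `[2, m)`. -/
theorem smallFactor_split {m : ℕ} (hm : 2 ≤ m) (hp : smallFactor m ≠ m) :
    smallFactor m * (m / smallFactor m) = m ∧ smallFactor m < m ∧ 2 ≤ m / smallFactor m ∧ m / smallFactor m < m := by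
  have hd := smallFactor_dvd m
  have h2 := two_le_smallFactor hm
  have hmul : smallFactor m * (m / smallFactor m) = m := Nat.mul_div_cancel' hd
  have hlt : smallFactor m < m := lt_of_le_of_ne (Nat.le_of_dvd (by omega) hd) hp
  refine ⟨hmul, hlt, ?_, ?_⟩
  · -- `m / p ≥ 2`: otherwise `m = p · (m/p) ≤ p < m`
    by_contra hlt2
    have hq : m / smallFactor m ≤ 1 := by omega
    have : m ≤ smallFactor m := by
      calc m = smallFactor m * (m / smallFactor m) := hmul.symm
        _ ≤ smallFactor m * 1 := Nat.mul_le_mul_left _ hq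
        _ = smallFactor m := by ring
    omega
  · exact Nat.div_lt_self (by omega) (by omega)

/-! ### `primeRow`, `stepRow` pointwise -/

/-- Length of a base row. -/
theorem primeRow_length (tcs : List ℕ) (L τ : ℕ) : ∀ js : List ℕ, (primeRow tcs L τ js).2.length = js.length
  | [] => rfl
  | j :: js => by simp [primeRow, primeRow_length tcs L τ js]

/-- Entries of a base row are the `primeVal`s; the row flag implies every entry flag.  (Proofs rewrite with the
equation lemmas only: a bare `rfl` would make the kernel unfold `primeVal` on symbolic arguments and expand the
offset `2^200` in unary — «deep recursion».) -/
theorem primeRow_get (tcs : List ℕ) (L τ : ℕ) :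
    ∀ (js : List ℕ) (k : ℕ), k < js.length →
      (primeRow tcs L τ js).2.getD k (0, 0) = (primeVal tcs L (js.getD k 0) τ).2 ∧
        ((primeRow tcs L τ js).1 = true → (primeVal tcs L (js.getD k 0) τ).1 = true)
  | [], k, hk => absurd hk (Nat.not_lt_zero k)
  | j :: js, 0, _ => by
    simp only [primeRow, List.getD_cons_zero, Bool.and_eq_true]
    exact ⟨trivial, fun h => h.1⟩
  | j :: js, k + 1, hk => by
    have hk' : k < js.length := Nat.lt_of_succ_lt_succ hk
    obtain ⟨h1, h2⟩ := primeRow_get tcs L τ js k hk'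
    simp only [primeRow, List.getD_cons_succ, Bool.and_eq_true]
    exact ⟨h1, fun h => h2 h.2⟩

/-- Length of a composite row. -/
theorem stepRow_length : ∀ a b : List (ℕ × ℕ), (stepRow a b).length = min a.length b.length
  | [], [] => rfl
  | [], _ :: _ => rfl
  | _ :: _, [] => rfl
  | x :: xs, y :: ys => by simp [stepRow, stepRow_length xs ys, Nat.add_min_add_right]

/-- Entries of a composite row are the rounded complex products of the corresponding entries. -/
theorem stepRow_get : ∀ (a b : List (ℕ × ℕ)) (k : ℕ), k < a.length → k < b.length →
    (stepRow a b).getD k (0, 0) =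
      (cmulRe (a.getD k (0, 0)).1 (a.getD k (0, 0)).2 (b.getD k (0, 0)).1 (b.getD k (0, 0)).2,
        cmulIm (a.getD k (0, 0)).1 (a.getD k (0, 0)).2 (b.getD k (0, 0)).1 (b.getD k (0, 0)).2)
  | [], _, k, hk, _ => absurd hk (Nat.not_lt_zero k)
  | _ :: _, [], k, _, hk => absurd hk (Nat.not_lt_zero k)
  | x :: xs, y :: ys, 0, _, _ => by simp only [stepRow, List.getD_cons_zero]
  | x :: xs, y :: ys, k + 1, hka, hkb => by
    simp only [stepRow, List.getD_cons_succ]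
    exact stepRow_get xs ys k (Nat.lt_of_succ_lt_succ hka) (Nat.lt_of_succ_lt_succ hkb)

/-! ### `buildRows` bookkeeping -/

/-- The flag of `buildRows` can only stay `true` if it started `true`. -/
theorem buildRows_flag_mono (tcs : List ℕ) (logs : List Literature.Analysis.ValidatedNumerics.Numerics.FI)
    (τ : ℕ) (js : List ℕ) :
    ∀ (fuel : ℕ) (acc : List (ℕ × List (ℕ × ℕ))) (ok : Bool),
      (buildRows tcs logs τ js fuel acc ok).2 = true → ok = true
  | 0, acc, ok, h => by simpa [buildRows] using h
  | fuel + 1, acc, ok, h => by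
    simp only [buildRows] at h
    split_ifs at h with hm hp
    · exact buildRows_flag_mono tcs logs τ js fuel _ _ h
    · have := buildRows_flag_mono tcs logs τ js fuel _ _ h
      rw [Bool.and_eq_true] at this
      exact this.1
    · have := buildRows_flag_mono tcs logs τ js fuel _ _ h
      rw [Bool.and_eq_true] at this
      exact this.1

/-- `buildRows` appends exactly `fuel` rows. -/
theorem buildRows_length (tcs : List ℕ) (logs : List Literature.Analysis.ValidatedNumerics.Numerics.FI)
    (τ : ℕ) (js : List ℕ) :
    ∀ (fuel : ℕ) (acc : List (ℕ × List (ℕ × ℕ))) (ok : Bool),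
      (buildRows tcs logs τ js fuel acc ok).1.length = acc.length + fuel
  | 0, acc, ok => by simp [buildRows]
  | fuel + 1, acc, ok => by
    simp only [buildRows]
    split_ifs <;> simp [buildRows_length tcs logs τ js fuel, Nat.add_assoc, Nat.add_comm 1 fuel]

/-- The rows already built are never changed: a prefix of the accumulator survives. -/
theorem buildRows_prefix (tcs : List ℕ) (logs : List Literature.Analysis.ValidatedNumerics.Numerics.FI)
    (τ : ℕ) (js : List ℕ) :
    ∀ (fuel : ℕ) (acc : List (ℕ × List (ℕ × ℕ))) (ok : Bool) (i : ℕ), i < acc.length →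
      (buildRows tcs logs τ js fuel acc ok).1.getD i (0, []) = acc.getD i (0, []) := by
  intro fuel
  induction fuel with
  | zero => intro acc ok i _; simp [buildRows]
  | succ fuel ih =>
    intro acc ok i hi
    simp only [buildRows]
    have happ : ∀ (x : ℕ × List (ℕ × ℕ)) (ok' : Bool),
        (buildRows tcs logs τ js fuel (acc ++ [x]) ok').1.getD i (0, []) = acc.getD i (0, []) := by
      intro x ok'
      rw [ih (acc ++ [x]) ok' i (by simp; omega), List.getD_append _ _ _ _ hi]
    split_ifs <;> exact happ _ _

end Summit.RiemannHypothesis.RiemannHypothesis.Theorems.IntegerScrew.Manifest.Fast
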